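import Summits.ValiantsHypothesis.ValiantsHypothesis.Theorems.SymPencilPerFourInnerRankSlots
import Summits.ValiantsHypothesis.ValiantsHypothesis.Theorems.SymPencilPerFourInnerRankNotBoth
import Summits.ValiantsHypothesis.ValiantsHypothesis.Theorems.SymPencilPerFourInnerRankConeFour

/-!
# Route `SymPencil` — inner rank of the `2 | 2` row split of `per_4`: the "common kernel
# hyperplane" form of the `y₂`-block dies unless the hyperplane is a coordinate hyperplane
# (`--supports` stmt-ValiantsHypothesis-5674 `SdcSuperquadratic`; (8,8) column, isotropic-kernel
# route, step (B5)(iii-a) of memo `NOTE-p6g15-5674-IR12-reduction.md` §10)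

**Theorem** (`false_of_kernel_form`).  Let `Σ_r c_r t_r((a,b),(y₂,y₃))² = per (a; b; y₂; y₃)`
with `|ι| ≤ 11` squares and non-zero weights.  Suppose a linear functional `φ` on `K⁴` kills the
`y₂`-blocks of all `a`-parts (`φ x = 0 ⇒ t_r((a,0),(x,0)) = 0`; the second alternative of
`RankOne.rank_one_family` for `a ↦ A₂(a)`), and `ker φ` contains a vector `y₀` with non-zero
coordinates (i.e. `ker φ` is not a coordinate hyperplane).  Then alternative (iY₂) of
`Slots.slotY₂_rank_le_one` holds: for every `y`, `a ↦ (t_r((a,0),(y,0)))_r` has rank `≤ 1`.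

Proof.  The `y₂`-slot kernel `Z(y₀) = {(a,b) : t_r((a,b),(y₀,0)) = 0 ∀ r}` contains `K⁴ ⊕ 0`, so
has dimension `≥ 4` and (ConeFour on the transposed design) is contained in `K⁴ ⊕ 0`: the map
`b ↦ (t_r((0,b),(y₀,0)))_r` is injective, of rank `4`, refuting (iiY₂); so (iY₂).  Consequence
(next file): with (iA) this forces the FIRST form `A₂(a)y = ψ(a,y)·v₀`.  Honest framing: a step
in a conditional reduction of the cells `(8,8,10)`, `(8,8,11)`; nothing about the window, the
crux or `VP ≠ VNP`.  No definitions, no named facts. [folklore]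
-/

noncomputable section

-- single-conjunct layout: Sub = Summit, duplicated namespace component intended
set_option linter.dupNamespace false

namespace Summit.ValiantsHypothesis.ValiantsHypothesis.Theorems.SymPencilPerFourInnerRankKernelForm

open Matrix Finset Module
open Summit.ValiantsHypothesis.ValiantsHypothesis.Theorems.SymPencilPerFourInnerRankSlotKernel
open Summit.ValiantsHypothesis.ValiantsHypothesis.Theorems.SymPencilPerFourInnerRankConeFour
open Summit.ValiantsHypothesis.ValiantsHypothesis.Theorems.SymPencilPerFourInnerRankSlots
open Summit.ValiantsHypothesis.ValiantsHypothesis.Theorems.SymPencilPerFourInnerRankNotBoth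

variable {K : Type*} [Field K] {ι : Type*} [Fintype ι]

/-- **Kernel form with a non-coordinate hyperplane ⇒ (iY₂).**  See the module docstring.
[folklore] -/
theorem iY₂_of_kernel_form [CharZero K] [DecidableEq ι] (hι : Fintype.card ι ≤ 11)
    (c : ι → K) (hc : ∀ r, c r ≠ 0)
    (t : ι → (((Fin 4 → K) × (Fin 4 → K)) →ₗ[K] ((Fin 4 → K) × (Fin 4 → K)) →ₗ[K] K))
    (hJ : ∀ a b y₂ y₃ : Fin 4 → K,
      ∑ r, c r * (t r (a, b) (y₂, y₃)) ^ 2 = (Matrix.of ![a, b, y₂, y₃]).permanent)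
    (φ : (Fin 4 → K) →ₗ[K] K) (hker : ∀ a x, φ x = 0 → ∀ r, t r (a, 0) (x, 0) = 0)
    (y₀ : Fin 4 → K) (hy₀ : φ y₀ = 0) (hy₀' : ∀ i, y₀ i ≠ 0) :
    ∀ (y x x' : Fin 4 → K) (r r' : ι),
      t r (x, 0) (y, 0) * t r' (x', 0) (y, 0) - t r (x', 0) (y, 0) * t r' (x, 0) (y, 0) = 0 := by
  rcases slotY₂_rank_le_one hι c hc t hJ with h | h
  · exact h
  exfalso
  -- the transposed design and its `a`-slot kernel at `y₀`
  set tT : ι → (((Fin 4 → K) × (Fin 4 → K)) →ₗ[K] ((Fin 4 → K) × (Fin 4 → K)) →ₗ[K] K) :=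
    fun r => (t r).flip with htT
  have hJT : ∀ a b y₂ y₃ : Fin 4 → K,
      ∑ r, c r * (tT r (a, b) (y₂, y₃)) ^ 2 = (Matrix.of ![a, b, y₂, y₃]).permanent :=
    hJ_transpose c t hJ
  set W := LinearMap.ker (LinearMap.pi fun r => tT r (y₀, 0)) with hW
  have hmemW : ∀ u : (Fin 4 → K) × (Fin 4 → K), u ∈ W ↔ ∀ r, t r u (y₀, 0) = 0 := by
    intro u
    rw [hW, LinearMap.mem_ker]
    constructor
    · intro hu r; have := congr_fun hu r; simpa [htT] using this
    · intro hu; funext r; simpa [htT] using hu r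
  -- `K⁴ ⊕ 0 ⊆ W`
  have hA : ∀ a : Fin 4 → K, ((a, 0) : (Fin 4 → K) × (Fin 4 → K)) ∈ W := fun a =>
    (hmemW _).2 (hker a y₀ hy₀)
  have h4 : 4 ≤ finrank K W := by
    have hle : LinearMap.range (LinearMap.inl K (Fin 4 → K) (Fin 4 → K)) ≤ W := by
      rintro _ ⟨a, rfl⟩; exact hA a
    have := Submodule.finrank_mono hle
    rw [LinearMap.finrank_range_of_inj LinearMap.inl_injective, finrank_fintype_fun_eq_card,
      Fintype.card_fin] at this
    exact this
  -- ConeFour: `W` is one-sided; it contains `(𝟙, 0)`, so `W ⊆ K⁴ ⊕ 0`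
  have hcone : ∀ w ∈ W, ∀ l : Fin 4,
      (Matrix.of ![y₀, Pi.single l 1, w.1, w.2]).permanent = 0 :=
    fun w hw l => ker_slotA_cone c tT hJT y₀ w hw l
  rcases fst_or_snd_of_four_le_diag y₀ hy₀' W hcone h4 with hfst | hsnd
  swap
  · have := hsnd _ (hA fun _ => 1)
    have h1 := congr_fun this 0
    simp at h1
  -- `b ↦ (t_r((0,b),(y₀,0)))_r` is injective, hence of rank 4, contradicting (iiY₂) at `y₀`
  let N : (Fin 4 → K) →ₗ[K] (ι → K) :=
    (LinearMap.pi fun r => (t r).flip (y₀, 0)) ∘ₗ LinearMap.inr K (Fin 4 → K) (Fin 4 → K)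
  have hN : ∀ b r, N b r = t r (0, b) (y₀, 0) := fun b r => rfl
  have hinj : Function.Injective N := by
    rw [← LinearMap.ker_eq_bot, LinearMap.ker_eq_bot']
    intro b hb
    have hbW : ((0, b) : (Fin 4 → K) × (Fin 4 → K)) ∈ W :=
      (hmemW _).2 fun r => by rw [← hN, hb]; rfl
    exact hfst _ hbW
  have h4N : finrank K (LinearMap.range N) = 4 := by
    rw [LinearMap.finrank_range_of_inj hinj, finrank_fintype_fun_eq_card, Fintype.card_fin]
  have h1N : finrank K (LinearMap.range N) ≤ 1 :=
    finrank_range_le_one_of_minors N fun b b' r r' => by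
      simp only [hN]; linear_combination h y₀ b b' r r'
  omega

end Summit.ValiantsHypothesis.ValiantsHypothesis.Theorems.SymPencilPerFourInnerRankKernelForm

end
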